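import Literature.Analysis.SpecialFunctions.SpheroidalHarmonicEigenfunction
import Mathlib.MeasureTheory.Integral.IntervalIntegral.FundThmCalculus
import HarnessLib

/-!
# Spectral identities for complex spheroidal eigenvalues: `Im λ · N = −Im κ · C`

Topic `Literature/Analysis/SpecialFunctions` (namespace `Literature.Analysis.SpecialFunctions`),
continuing `SpheroidalHarmonicEigenfunction.lean`. For a zero `(ν, κ) ∈ ℂ²` of the shooting
function (so that `E = sphmEig m ν κ` is a genuine even eigenfunction on `[−1, 1]`,
`λ = ν + m(m+1)`), multiplying `((1−x²)^{m+1}E')' = −(ν + κx²)(1−x²)^m E` by `Ē` and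
integrating over `[−1, 1]` (no boundary terms: the weight vanishes at `±1`) gives the
**virial identity**
`∫_{−1}^{1}(1−x²)^{m+1}|E'|² = ν ∫(1−x²)^m|E|² + κ ∫x²(1−x²)^m|E|²` (`sphmEig_virial`), i.e. with
`N = ∫(1−x²)^m|E|² > 0`, `0 < C = ∫x²(1−x²)^m|E|² < N`, `P = ∫(1−x²)^{m+1}|E'|² ≥ 0`:
`Im ν · N + Im κ · C = 0` and `Re ν · N + Re κ · C = P ≥ 0` (`exists_spectral_identity`).
These are the Prop. B.1/B.2-type bounds ("eigBound1") of Shlapentokh-Rothman, CMP 329 (2014),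
App. B, used in his Prop. 4.6 (superradiance of the unstable modes): with `κ = a²(ω² − μ²)`,
`Im λ = −τ Im κ` (`τ = C/N ∈ (0,1)`) and `Re λ ≥ m(m+1) − τ Re κ`. Everything is proved.

## References

* Y. Shlapentokh-Rothman, Comm. Math. Phys. 329 (2014) 859–891, App. B (Props. B.1–B.3),
  Prop. 4.6. Key `ShlapentokhRothman2014KleinGordon`.
-/

noncomputable section

open Set Filter Metric Complex intervalIntegral
open scoped Topology ComplexConjugate ContDiff

namespace Literature.Analysis.SpecialFunctions

open Literature.Analysis.ODE

section Virial

variable {m : ℕ} {ν κ : ℂ} (hg : sphmDer m ν κ 1 = 0)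
include hg

/-- `E` is `C²` with `HasDerivAt` for `E` and `E'` on the wide interval. [folklore] -/
theorem hasDerivAt_sphmEig_pair {x : ℝ} (hx : x ∈ Ioo (-9 / 4 : ℝ) (9 / 4)) :
    HasDerivAt (sphmEig m ν κ) (deriv (sphmEig m ν κ) x) x ∧
      HasDerivAt (deriv (sphmEig m ν κ)) (deriv (deriv (sphmEig m ν κ)) x) x := by
  have hC : ContDiffAt ℝ 2 (sphmEig m ν κ) x := contDiffAt_sphmEig hg hx (by norm_cast)
  have h1 : HasDerivAt (sphmEig m ν κ) (deriv (sphmEig m ν κ) x) x := (hC.differentiableAt (by norm_num)).hasDerivAt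
  have hF : ContDiffAt ℝ 1 (fderiv ℝ (sphmEig m ν κ)) x := hC.fderiv_right (by norm_num)
  have hD : ContDiffAt ℝ 1 (fun y ↦ fderiv ℝ (sphmEig m ν κ) y 1) x :=
    (ContinuousLinearMap.apply ℝ ℂ (1 : ℝ)).contDiff.contDiffAt.comp x hF
  have hD' : ContDiffAt ℝ 1 (deriv (sphmEig m ν κ)) x := hD
  exact ⟨h1, (hD'.differentiableAt one_ne_zero).hasDerivAt⟩

/-- `E`, `E'` are continuous on `[−1, 1]`. [folklore] -/
theorem continuousOn_sphmEig_pair :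
    ContinuousOn (sphmEig m ν κ) (Icc (-1 : ℝ) 1) ∧ ContinuousOn (deriv (sphmEig m ν κ)) (Icc (-1 : ℝ) 1) := by
  refine ⟨fun x hx ↦ ?_, fun x hx ↦ ?_⟩
  · exact (hasDerivAt_sphmEig_pair hg ⟨by linarith [hx.1], by linarith [hx.2]⟩).1.continuousAt.continuousWithinAt
  · exact (hasDerivAt_sphmEig_pair hg ⟨by linarith [hx.1], by linarith [hx.2]⟩).2.continuousAt.continuousWithinAt

/-- The virial quantity `Φ(x) = (1 − x²)^{m+1} E'(x) conj(E(x))`. [folklore] -/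
def virialPhi (m : ℕ) (ν κ : ℂ) (x : ℝ) : ℂ :=
  (1 - (x : ℂ) ^ 2) ^ (m + 1) * deriv (sphmEig m ν κ) x * conj (sphmEig m ν κ x)

/-- **The virial derivative**:
`Φ'(x) = (1−x²)^{m+1}|E'|² − (ν + κx²)(1−x²)^m |E|²` (as complex numbers `E'·conj E'`,
`E·conj E`) on the wide interval. [cite: ShlapentokhRothman2014KleinGordon, App. B] -/
theorem hasDerivAt_virialPhi {x : ℝ} (hx : x ∈ Ioo (-9 / 4 : ℝ) (9 / 4)) :
    HasDerivAt (virialPhi m ν κ)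
      ((1 - (x : ℂ) ^ 2) ^ (m + 1) * (deriv (sphmEig m ν κ) x * conj (deriv (sphmEig m ν κ) x)) -
        (ν + κ * (x : ℂ) ^ 2) * (1 - (x : ℂ) ^ 2) ^ m * (sphmEig m ν κ x * conj (sphmEig m ν κ x))) x := by
  obtain ⟨hE, hE'⟩ := hasDerivAt_sphmEig_pair hg hx
  have hode := sphmEig_ode hg hx
  -- derivative of the weight
  have hc : HasDerivAt (fun y : ℝ ↦ (y : ℂ)) 1 x := (hasDerivAt_id' x).ofReal_comp
  have hP : HasDerivAt (fun y : ℝ ↦ (1 - (y : ℂ) ^ 2) ^ (m + 1))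
      ((((m + 1 : ℕ) : ℂ)) * (1 - (x : ℂ) ^ 2) ^ (m + 1 - 1) * (-(2 * (x : ℂ)))) x := by
    have h1 : HasDerivAt (fun y : ℝ ↦ (1 : ℂ) - (y : ℂ) ^ 2) (-(2 * (x : ℂ))) x := by
      have h := (hc.mul hc).const_sub (1 : ℂ)
      have hf : (fun y : ℝ ↦ (1 : ℂ) - (y : ℂ) ^ 2) = fun y : ℝ ↦ (1 : ℂ) - (y : ℂ) * (y : ℂ) := by
        funext y; ring
      rw [hf]
      refine h.congr_deriv ?_
      ring
    exact (hasDerivAt_pow (m + 1) ((1 : ℂ) - (x : ℂ) ^ 2)).comp x h1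
  have hconj : HasDerivAt (fun y : ℝ ↦ conj (sphmEig m ν κ y)) (conj (deriv (sphmEig m ν κ) x)) x := hE.star
  have hprod := (hP.fun_mul hE').fun_mul hconj
  unfold virialPhi
  refine hprod.congr_deriv ?_
  simp only [Nat.add_sub_cancel]
  push_cast
  set X : ℂ := (x : ℂ)
  set E0 := sphmEig m ν κ x
  set E1 := deriv (sphmEig m ν κ) x
  set E2 := deriv (deriv (sphmEig m ν κ)) x
  -- `hode : (1 - X²) E2 - 2(m+1) X E1 + (ν + κ X²) E0 = 0`
  linear_combination ((1 - X ^ 2) ^ m * conj E0) * hode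

/-- **The virial identity**: for a zero of the shooting function,
`∫_{−1}^{1} (1−x²)^{m+1} E'·conj E' = ν ∫_{−1}^{1} (1−x²)^m E·conj E + κ ∫_{−1}^{1} x²(1−x²)^m E·conj E`
(FTC for `Φ` on `[−1, 1]`; the weight kills both boundary terms). [cite: ShlapentokhRothman2014KleinGordon, App. B] -/
theorem sphmEig_virial :
    ∫ x in (-1 : ℝ)..1, (1 - (x : ℂ) ^ 2) ^ (m + 1) * (deriv (sphmEig m ν κ) x * conj (deriv (sphmEig m ν κ) x)) =
      ν * (∫ x in (-1 : ℝ)..1, (1 - (x : ℂ) ^ 2) ^ m * (sphmEig m ν κ x * conj (sphmEig m ν κ x))) +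
        κ * (∫ x in (-1 : ℝ)..1, (x : ℂ) ^ 2 * (1 - (x : ℂ) ^ 2) ^ m * (sphmEig m ν κ x * conj (sphmEig m ν κ x))) := by
  obtain ⟨hcE, hcE'⟩ := continuousOn_sphmEig_pair hg
  set E := sphmEig m ν κ with hE_def
  -- continuity of the ingredients on `[-1, 1]`
  have hw1 : Continuous fun x : ℝ ↦ (1 - (x : ℂ) ^ 2) ^ (m + 1) := by fun_prop
  have hw0 : Continuous fun x : ℝ ↦ (1 - (x : ℂ) ^ 2) ^ m := by fun_prop
  have hx2 : Continuous fun x : ℝ ↦ (x : ℂ) ^ 2 := by fun_prop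
  have hcc : ContinuousOn (fun x ↦ conj (E x)) (Icc (-1 : ℝ) 1) := Complex.continuous_conj.comp_continuousOn hcE
  have hcc' : ContinuousOn (fun x ↦ conj (deriv E x)) (Icc (-1 : ℝ) 1) := Complex.continuous_conj.comp_continuousOn hcE'
  have hA : ContinuousOn (fun x : ℝ ↦ (1 - (x : ℂ) ^ 2) ^ (m + 1) * (deriv E x * conj (deriv E x))) (Icc (-1 : ℝ) 1) :=
    hw1.continuousOn.mul (hcE'.mul hcc')
  have hB : ContinuousOn (fun x : ℝ ↦ (1 - (x : ℂ) ^ 2) ^ m * (E x * conj (E x))) (Icc (-1 : ℝ) 1) :=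
    hw0.continuousOn.mul (hcE.mul hcc)
  have hC : ContinuousOn (fun x : ℝ ↦ (x : ℂ) ^ 2 * (1 - (x : ℂ) ^ 2) ^ m * (E x * conj (E x))) (Icc (-1 : ℝ) 1) :=
    (hx2.continuousOn.mul hw0.continuousOn).mul (hcE.mul hcc)
  have hle : (-1 : ℝ) ≤ 1 := by norm_num
  -- FTC for `Φ`
  have hderiv : ∀ x ∈ uIcc (-1 : ℝ) 1, HasDerivAt (virialPhi m ν κ)
      ((1 - (x : ℂ) ^ 2) ^ (m + 1) * (deriv E x * conj (deriv E x)) -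
        (ν + κ * (x : ℂ) ^ 2) * (1 - (x : ℂ) ^ 2) ^ m * (E x * conj (E x))) x := by
    intro x hx
    rw [uIcc_of_le hle] at hx
    exact hasDerivAt_virialPhi hg ⟨by linarith [hx.1], by linarith [hx.2]⟩
  have hint : IntervalIntegrable (fun x : ℝ ↦ (1 - (x : ℂ) ^ 2) ^ (m + 1) * (deriv E x * conj (deriv E x)) -
      (ν + κ * (x : ℂ) ^ 2) * (1 - (x : ℂ) ^ 2) ^ m * (E x * conj (E x))) MeasureTheory.volume (-1) 1 := by
    refine (ContinuousOn.intervalIntegrable ?_)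
    rw [uIcc_of_le hle]
    have hD : ContinuousOn (fun x : ℝ ↦ (ν + κ * (x : ℂ) ^ 2) * (1 - (x : ℂ) ^ 2) ^ m * (E x * conj (E x))) (Icc (-1 : ℝ) 1) :=
      ((continuous_const.add (continuous_const.mul hx2)).continuousOn.mul hw0.continuousOn).mul (hcE.mul hcc)
    exact hA.sub hD
  have hFTC := integral_eq_sub_of_hasDerivAt hderiv hint
  have h1 : virialPhi m ν κ 1 = 0 := by simp [virialPhi]
  have h2 : virialPhi m ν κ (-1) = 0 := by simp [virialPhi]
  rw [h1, h2, sub_zero] at hFTC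
  -- split the integral
  rw [intervalIntegral.integral_sub (hA.intervalIntegrable_of_Icc hle) ?hD] at hFTC
  case hD =>
    exact (((continuous_const.add (continuous_const.mul hx2)).continuousOn.mul hw0.continuousOn).mul
      (hcE.mul hcc)).intervalIntegrable_of_Icc hle
  have hsplit : ∫ x in (-1 : ℝ)..1, (ν + κ * (x : ℂ) ^ 2) * (1 - (x : ℂ) ^ 2) ^ m * (E x * conj (E x)) =
      ν * (∫ x in (-1 : ℝ)..1, (1 - (x : ℂ) ^ 2) ^ m * (E x * conj (E x))) +
        κ * (∫ x in (-1 : ℝ)..1, (x : ℂ) ^ 2 * (1 - (x : ℂ) ^ 2) ^ m * (E x * conj (E x))) := by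
    rw [← intervalIntegral.integral_const_mul, ← intervalIntegral.integral_const_mul,
      ← intervalIntegral.integral_add ((hB.intervalIntegrable_of_Icc hle).const_mul ν)
        ((hC.intervalIntegrable_of_Icc hle).const_mul κ)]
    refine integral_congr fun x _ ↦ ?_
    ring
  rw [hsplit] at hFTC
  linear_combination hFTC

end Virial

/-! ### Real and imaginary parts: the spectral identity -/

section Spectral

variable {m : ℕ} {ν κ : ℂ}

/-- **The spectral identity (SR App. B, "eigBound1").** For a zero `(ν, κ)` of the shooting
function there are reals `N, C, P` with `0 < C < N`, `0 ≤ P`, and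
`ν N + κ C = P` as complex numbers — whence `Im ν · N + Im κ · C = 0` and
`Re ν · N + Re κ · C = P ≥ 0`: `N = ∫(1−x²)^m|E|²`, `C = ∫x²(1−x²)^m|E|²`,
`P = ∫(1−x²)^{m+1}|E'|²`. With `κ = a²(ω² − μ²)`, `λ = ν + m(m+1)`: `Im λ = −(C/N) Im κ`.
[cite: ShlapentokhRothman2014KleinGordon, App. B] -/
theorem exists_spectral_identity (hg : sphmDer m ν κ 1 = 0) :
    ∃ N C P : ℝ, 0 < C ∧ C < N ∧ 0 ≤ P ∧ ν * N + κ * C = P ∧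
      (ν.im * N + κ.im * C = 0) ∧ (ν.re * N + κ.re * C = P) := by
  obtain ⟨hcE, hcE'⟩ := continuousOn_sphmEig_pair hg
  have hvir := sphmEig_virial hg
  set E := sphmEig m ν κ with hE_def
  have hle : (-1 : ℝ) ≤ 1 := by norm_num
  -- the real integrands
  set nE : ℝ → ℝ := fun x ↦ ‖E x‖ ^ 2 with hnE
  set gN : ℝ → ℝ := fun x ↦ (1 - x ^ 2) ^ m * nE x with hgN
  set gC : ℝ → ℝ := fun x ↦ x ^ 2 * ((1 - x ^ 2) ^ m * nE x) with hgC
  set gP : ℝ → ℝ := fun x ↦ (1 - x ^ 2) ^ (m + 1) * ‖deriv E x‖ ^ 2 with hgP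
  have hnEc : ContinuousOn nE (Icc (-1 : ℝ) 1) := (hcE.norm).pow 2
  have hgNc : ContinuousOn gN (Icc (-1 : ℝ) 1) := (Continuous.continuousOn (by fun_prop)).mul hnEc
  have hgCc : ContinuousOn gC (Icc (-1 : ℝ) 1) := (continuous_pow 2).continuousOn.mul hgNc
  have hgPc : ContinuousOn gP (Icc (-1 : ℝ) 1) := (Continuous.continuousOn (by fun_prop)).mul ((hcE'.norm).pow 2)
  have hw0 : ∀ x ∈ Icc (-1 : ℝ) 1, 0 ≤ 1 - x ^ 2 := fun x hx ↦ by nlinarith [hx.1, hx.2]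
  have hgN0 : ∀ x ∈ Icc (-1 : ℝ) 1, 0 ≤ gN x := fun x hx ↦ by
    have := hw0 x hx; simp only [hgN, hnE]; positivity
  have hgC0 : ∀ x ∈ Icc (-1 : ℝ) 1, 0 ≤ gC x := fun x hx ↦ mul_nonneg (sq_nonneg x) (hgN0 x hx)
  have hgP0 : ∀ x ∈ Icc (-1 : ℝ) 1, 0 ≤ gP x := fun x hx ↦ by
    have := hw0 x hx; simp only [hgP]; positivity
  have hCN : ∀ x ∈ Icc (-1 : ℝ) 1, gC x ≤ gN x := fun x hx ↦ by
    have h1 : x ^ 2 ≤ 1 := by nlinarith [hx.1, hx.2]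
    calc gC x = x ^ 2 * gN x := rfl
      _ ≤ 1 * gN x := mul_le_mul_of_nonneg_right h1 (hgN0 x hx)
      _ = gN x := one_mul _
  -- a point near `x = 1` where `gC > 0` and `gC < gN`
  obtain ⟨c, hc0, hc1, hEc⟩ : ∃ c : ℝ, 1 / 2 < c ∧ c < 1 ∧ 1 / 2 < ‖E c‖ := by
    have hcont : ContinuousAt (fun x ↦ ‖E x‖) 1 :=
      ((hasDerivAt_sphmEig_pair hg (x := 1) ⟨by norm_num, by norm_num⟩).1.continuousAt).norm
    have h1 : ‖E 1‖ = 1 := by rw [hE_def, sphmEig_one]; simp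
    have hev : ∀ᶠ x in 𝓝 (1 : ℝ), 1 / 2 < ‖E x‖ := hcont.eventually (lt_mem_nhds (by show 1 / 2 < ‖E 1‖; rw [h1]; norm_num))
    have hev' : ∀ᶠ x in 𝓝[<] (1 : ℝ), 1 / 2 < ‖E x‖ ∧ x ∈ Ioo (1 / 2 : ℝ) 1 :=
      (hev.filter_mono nhdsWithin_le_nhds).and (Ioo_mem_nhdsLT (by norm_num))
    obtain ⟨c, hc1, hc2⟩ := hev'.exists
    exact ⟨c, hc2.1, hc2.2, hc1⟩
  have hcI : c ∈ Icc (-1 : ℝ) 1 := ⟨by linarith, hc1.le⟩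
  have hwc : 0 < 1 - c ^ 2 := by nlinarith
  have hposC : 0 < gC c := by
    simp only [hgC, hnE]
    have : 0 < ‖E c‖ := by linarith
    positivity
  have hltCN : gC c < gN c := by
    have h3 : c ^ 2 < 1 := by nlinarith
    have hgNpos : 0 < gN c := by
      simp only [hgN, hnE]; have : 0 < ‖E c‖ := by linarith
      positivity
    calc gC c = c ^ 2 * gN c := rfl
      _ < 1 * gN c := mul_lt_mul_of_pos_right h3 hgNpos
      _ = gN c := one_mul _
  -- the real integrals
  set N : ℝ := ∫ x in (-1 : ℝ)..1, gN x with hN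
  set C : ℝ := ∫ x in (-1 : ℝ)..1, gC x with hC
  set P : ℝ := ∫ x in (-1 : ℝ)..1, gP x with hP
  have hCpos : 0 < C := by
    have h := integral_lt_integral_of_continuousOn_of_le_of_exists_lt (by norm_num : (-1 : ℝ) < 1) continuousOn_const hgCc
      (fun x hx ↦ hgC0 x (Ioc_subset_Icc_self hx)) ⟨c, hcI, hposC⟩
    simpa using h
  have hCltN : C < N :=
    integral_lt_integral_of_continuousOn_of_le_of_exists_lt (by norm_num : (-1 : ℝ) < 1) hgCc hgNc
      (fun x hx ↦ hCN x (Ioc_subset_Icc_self hx)) ⟨c, hcI, hltCN⟩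
  have hPnn : 0 ≤ P := intervalIntegral.integral_nonneg hle fun x hx ↦ hgP0 x hx
  -- identify the complex integrals with the real ones
  have hIN : ∫ x in (-1 : ℝ)..1, (1 - (x : ℂ) ^ 2) ^ m * (E x * conj (E x)) = (N : ℂ) := by
    rw [hN, ← intervalIntegral.integral_ofReal]
    refine integral_congr fun x _ ↦ ?_
    simp only [hgN, hnE, Complex.mul_conj']
    push_cast; ring
  have hIC : ∫ x in (-1 : ℝ)..1, (x : ℂ) ^ 2 * (1 - (x : ℂ) ^ 2) ^ m * (E x * conj (E x)) = (C : ℂ) := by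
    rw [hC, ← intervalIntegral.integral_ofReal]
    refine integral_congr fun x _ ↦ ?_
    simp only [hgC, hnE, Complex.mul_conj']
    push_cast; ring
  have hIP : ∫ x in (-1 : ℝ)..1, (1 - (x : ℂ) ^ 2) ^ (m + 1) * (deriv E x * conj (deriv E x)) = (P : ℂ) := by
    rw [hP, ← intervalIntegral.integral_ofReal]
    refine integral_congr fun x _ ↦ ?_
    simp only [hgP, Complex.mul_conj']
    push_cast; ring
  rw [hIN, hIC, hIP] at hvir
  have key : ν * N + κ * C = P := hvir.symm
  refine ⟨N, C, P, hCpos, hCltN, hPnn, key, ?_, ?_⟩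
  · have h := congrArg Complex.im key
    simp only [Complex.add_im, Complex.mul_im, Complex.ofReal_re, Complex.ofReal_im, mul_zero, zero_add] at h
    linarith
  · have h := congrArg Complex.re key
    simp only [Complex.add_re, Complex.mul_re, Complex.ofReal_re, Complex.ofReal_im, mul_zero, sub_zero] at h
    linarith

/-- **Corollary (the shape used in Prop. 4.6 of SR):** there is `τ ∈ (0, 1)` with
`Im ν = −τ · Im κ` and `Re ν ≥ −τ · Re κ`. [cite: ShlapentokhRothman2014KleinGordon, App. B] -/
theorem exists_tau_spectral (hg : sphmDer m ν κ 1 = 0) :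
    ∃ τ : ℝ, 0 < τ ∧ τ < 1 ∧ ν.im = -τ * κ.im ∧ -τ * κ.re ≤ ν.re := by
  obtain ⟨N, C, P, hC, hCN, hP, -, him, hre⟩ := exists_spectral_identity hg
  have hN : 0 < N := hC.trans hCN
  refine ⟨C / N, div_pos hC hN, (div_lt_one hN).2 hCN, ?_, ?_⟩
  · field_simp
    linarith
  · rw [show -(C / N) * κ.re = -(κ.re * C) / N by ring, div_le_iff₀ hN]
    linarith

end Spectral

end Literature.Analysis.SpecialFunctions

end
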